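import Summits.Ventures.PercRepro.C026GluingDefs

/-!
# A cut vertex: the connectivity dictionary and the product of configurations (p5, gen 15)

mine-3 (`proofs/MINE3-BLOCKS.md` §0): «configurations of a graph with a cut vertex are pairs, and the
three-mark events factor». A cut vertex `v` of a two-colouring `side : E → Bool` is p6's 3-terminal gluing
with all three terminals equal to `v` (`IsGluing v v v side`: every other vertex carries edges of one colour);
the two sides are `G.part side true` and `G.part side false` (C026GluingDefs), and a configuration of `G` is
the pair of its restrictions (`sideEquiv`).

* `OnSide side s x` — every edge at `x` has colour `s`; `sideRestrict_compl` — restriction commutes with the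
  complement (closed connectivity factors like open connectivity);
* **`conn_cut_iff`** — for `x` on side `s` (or `x = v`): `x ~ y` in `G` iff `x ~ y` on side `s`, or `x ~ v` on
  side `s` and `v ~ y` on the other side `t ≠ s`; `conn_cut_iff_same` (both on side `s`: `x ~ y` iff `x ~_s y`);
  `conn_cut_iff_cross` (`x` on side `s`, `y ≠ x` on the other: iff `x ~_s v ∧ v ~_{!s} y`);
* **`card_filter_cut`** — the count of a product event is the product of the counts on the two sides.
-/

namespace PercRepro

open Finset

namespace MultiGraph

section CutVertex

variable {V E : Type*} (G : MultiGraph V E)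

/-- `x` lies on side `s`: every edge at `x` has colour `s`. -/
def OnSide (side : E → Bool) (s : Bool) (x : V) : Prop := ∀ e, G.EdgeAt e x → side e = s

variable {G}

/-- Two distinct Booleans: a third one different from the first is the second. -/
theorem bool_eq_of_ne_of_ne {s t u : Bool} (hst : s ≠ t) (hus : u ≠ s) : u = t := by
  cases s <;> cases t <;> cases u <;> simp_all

/-- Restriction commutes with the complement. -/
theorem sideRestrict_compl (ω : Config E) (side : E → Bool) (s : Bool) :
    sideRestrict ωᶜ side s = (sideRestrict ω side s)ᶜ := by
  funext e
  rw [sideRestrict_apply, compl_apply_not, compl_apply_not, sideRestrict_apply]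

/-- An open edge of colour `s` is an open step of the part of colour `s`. -/
theorem openAdj_part_of_open' {side : E → Bool} {s : Bool} {ω : Config E} {e : E} {x y : V}
    (hs : side e = s) (he : ω e = true) (hj : G.Joins e x y) :
    (G.part side s).OpenAdj (sideRestrict ω side s) x y :=
  ⟨⟨e, hs⟩, he, hj⟩

/-- A vertex on side `s` carries no edge of another colour `t ≠ s`. -/
theorem not_hasCol_of_onSide {side : E → Bool} {s t : Bool} (hst : s ≠ t) {x : V}
    (hx : G.OnSide side s x) : ¬ G.HasCol side t x := by
  rintro ⟨e, hes, he⟩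
  exact hst ((hx e he).symm.trans hes)

/-- **The cut-vertex dictionary**: for `x` on side `s` (or `x = v`), `x ~ y` in `G` iff `x ~ y` on side `s`,
or `x ~ v` on side `s` and `v ~ y` on the other side `t` (a walk changes colour only at `v`). -/
theorem conn_cut_iff {v : V} {side : E → Bool} (hg : G.IsGluing v v v side) {s t : Bool} (hst : s ≠ t)
    {x : V} (hx : x = v ∨ G.OnSide side s x) (ω : Config E) (y : V) :
    G.Conn ω x y ↔ (G.part side s).Conn (sideRestrict ω side s) x y ∨
      ((G.part side s).Conn (sideRestrict ω side s) x v ∧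
        (G.part side t).Conn (sideRestrict ω side t) v y) := by
  constructor
  · intro h
    refine Conn.induction
      (motive := fun z => (G.part side s).Conn (sideRestrict ω side s) x z ∨
        ((G.part side s).Conn (sideRestrict ω side s) x v ∧
          (G.part side t).Conn (sideRestrict ω side t) v z))
      (Or.inl (Conn.refl _ _ _)) ?_ h
    intro z z' _ hzz' ih
    obtain ⟨e, he, hend⟩ := hzz'
    have hj : G.Joins e z z' := hend
    by_cases hse : side e = s
    · -- an edge of colour `s`
      rcases ih with hxz | ⟨hxv, hvz⟩
      · exact Or.inl (hxz.tail (openAdj_part_of_open' hse he hj))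
      · by_cases hzv : z = v
        · subst hzv
          exact Or.inl (hxv.tail (openAdj_part_of_open' hse he hj))
        · -- `z ≠ v` carries the colour `t` (the path from `v`) and the colour `s` (the edge): impossible
          exfalso
          have h1 : G.HasCol side t z := hasCol_of_conn_part hvz hzv
          have h2 : G.HasCol side s z := ⟨e, hse, EdgeAt.of_joins_left hj⟩
          exact hst (hg.eq_of_hasCol hzv hzv hzv h2 h1)
    · -- an edge of colour `t`
      have hse' : side e = t := bool_eq_of_ne_of_ne hst hse
      rcases ih with hxz | ⟨hxv, hvz⟩
      · by_cases hzv : z = v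
        · subst hzv
          exact Or.inr ⟨hxz, Conn.of_openAdj (openAdj_part_of_open' hse' he hj)⟩
        · exfalso
          by_cases hzx : z = x
          · subst hzx
            rcases hx with hx | hx
            · exact hzv hx
            · exact hse (hx e (EdgeAt.of_joins_left hj))
          · have h1 : G.HasCol side s z := hasCol_of_conn_part hxz hzx
            have h2 : G.HasCol side t z := ⟨e, hse', EdgeAt.of_joins_left hj⟩
            exact hst (hg.eq_of_hasCol hzv hzv hzv h1 h2)
      · exact Or.inr ⟨hxv, hvz.tail (openAdj_part_of_open' hse' he hj)⟩
  · rintro (h | ⟨h1, h2⟩)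
    · exact Conn.of_part h
    · exact (Conn.of_part h1).trans (Conn.of_part h2)

/-- **Two vertices on one side** (or `v`): `x ~ y` in `G` iff `x ~ y` on that side. -/
theorem conn_cut_iff_same {v : V} {side : E → Bool} (hg : G.IsGluing v v v side) {s t : Bool}
    (hst : s ≠ t) {x y : V} (hx : x = v ∨ G.OnSide side s x) (hy : y = v ∨ G.OnSide side s y)
    (ω : Config E) :
    G.Conn ω x y ↔ (G.part side s).Conn (sideRestrict ω side s) x y := by
  rw [conn_cut_iff hg hst hx]
  constructor
  · rintro (h | ⟨h1, h2⟩)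
    · exact h
    · rcases hy with hy | hy
      · rw [hy]
        exact h1
      · by_cases hyv : y = v
        · rw [hyv]
          exact h1
        · exact absurd (hasCol_of_conn_part h2 hyv) (not_hasCol_of_onSide hst hy)
  · exact Or.inl

/-- **Two vertices on different sides**: `x ~ y` in `G` iff `x ~ v` on `x`'s side and `v ~ y` on `y`'s. -/
theorem conn_cut_iff_cross {v : V} {side : E → Bool} (hg : G.IsGluing v v v side) {s t : Bool}
    (hst : s ≠ t) {x y : V} (hx : x = v ∨ G.OnSide side s x) (hy : G.OnSide side t y) (hxy : x ≠ y)
    (ω : Config E) :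
    G.Conn ω x y ↔ (G.part side s).Conn (sideRestrict ω side s) x v ∧
      (G.part side t).Conn (sideRestrict ω side t) v y := by
  rw [conn_cut_iff hg hst hx]
  constructor
  · rintro (h | h)
    · exfalso
      exact not_hasCol_of_onSide (Ne.symm hst) hy (hasCol_of_conn_part h (Ne.symm hxy))
    · exact h
  · exact Or.inr

open Classical in
/-- **The product of configurations**: a product event is counted by the product of the two sides' counts. -/
theorem card_filter_cut [Fintype E] (side : E → Bool) (P : Config {e // side e = true} → Prop)
    (Q : Config {e // side e = false} → Prop) :
    (univ.filter fun ω : Config E =>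
        P (sideRestrict ω side true) ∧ Q (sideRestrict ω side false)).card =
      (univ.filter P).card * (univ.filter Q).card := by
  rw [← Finset.card_product]
  refine Finset.card_nbij' (fun ω => sideEquiv side ω) (fun q => (sideEquiv side).symm q) ?_ ?_ ?_ ?_
  · intro ω hω
    simp only [Finset.coe_filter, Finset.mem_univ, true_and, Set.mem_setOf_eq, Finset.coe_product,
      Set.mem_prod] at hω ⊢
    exact hω
  · intro q hq
    simp only [Finset.coe_filter, Finset.mem_univ, true_and, Set.mem_setOf_eq, Finset.coe_product,
      Set.mem_prod, sideRestrict_symm_true, sideRestrict_symm_false] at hq ⊢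
    exact hq
  · intro ω _
    exact (sideEquiv side).symm_apply_apply ω
  · intro q _
    exact (sideEquiv side).apply_symm_apply q

end CutVertex

end MultiGraph

end PercRepro
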